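import Summits.ABC.ABC.Theorems.TwistAmplificationSharpModerateLawMazurKaneCalibration

/-!
# Crux `TwistAmplification.SharpModerateLaw` (stmt-ABC-1975), line `deep-moduli-cusp-dispersion`:
Frey pairs in the deep-regime set (support 1/2 of the calibration `deep-regime law → MazurKaneLaw`)

Support file 1/2 of the calibration `mazurKaneLaw_of_deepRegimeLaw` (file
`TwistAmplificationSharpModerateLawDeepRegimeCalibration.lean`): the conclusion of the line's hardest
stub `stub_deepRegime` — the cusp counting law C⁺′ on the DEEP regime (pairs `(c₄, c₆)` with
`c₄c₆ ≠ 0`, `Δ ≠ 0`, `1728 ∣ c₄³ − c₆²`, tower-free, dyadic level `M⁺ = max(|c₄|³, |Δ|) ∈ (Y/2, Y]`,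
full conductor proxy `N* = ∏_{p ∣ Δ} (p² if p ∣ c₄ else p) ≤ X`, thick tube `|c₄³ − c₆²| > 1728·Y^{1/2}`,
simple radical `r' = ∏_{p ∥ c₄³−c₆²} p < Y^{1/6}`) — is fed the Frey pairs
`freyPair a b = (16(a²+ab+b²), −32(b−a)(2a+b)(a+2b))` of abc triples (`…FreyPairs.lean`, sibling line
`syzygy-lattice-half-deep-few-primes`).  Proved here, for coprime `(a, b)`, `m = ab(a+b)`, `A = a²+ab+b²`:
* `nstar_freyPair_le` — the FULL proxy (primes `2, 3` included) is `≤ 2·rad(abc)`: the primes of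
  `Δ = 16m²` are those of `m` (`2 ∣ m`), an odd one does not divide `c₄ = 16A`
  (`not_dvd_freyA_of_dvd_abc`, charge `p`), and `2 ∣ c₄` is charged `2² = 2·2`;
* `simpleRad_freyPair_eq_one` — `c₄³ − c₆² = 1728·16·m² = 2¹⁰3³m²`, so every prime of it divides it
  squared: the simple radical is the empty product `1`;
* `box_finite` — `|u|³ ≤ Y`, `|u³ − v²| ≤ 1728Y` is a finite box, so deep-regime sets are finite;
* `freyPair_mem_deep` — membership of the Frey pair in the deep-regime set at `(X, Y)` (the set of
  `stub_deepRegime`, verbatim) once `2·rad ≤ X`, `(16A)³ ≤ Y < 2(16A)³`, `Y < 256m⁴`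
  (level `|c₄|³ = (16A)³ ∈ (Y/2, Y]` as `16m² ≤ (16A)³` by the syzygy `4A³ = P² + 27m²`; tube
  `1728·16m² > 1728·Y^{1/2}`; simple radical `1 < Y^{1/6}`);
* `two_mul_level_lt` — the level inequality `2(16A)³ < 256m⁴` for `a + b ≥ 9` that puts the dyadic
  levels of file 2/2 inside the tube condition.
-/

noncomputable section

namespace Summit.ABC.ABC.Theorems.SharpModerateLaw.CuspDispersion

open Literature.NumberTheory.DiophantineGeometry (IsABCTriple rad)


/-! ## 1. Invariants of the Frey pair entering the deep-regime set -/

/-- A prime dividing `16` is `2`. -/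
theorem eq_two_of_dvd_sixteen {p : ℕ} (hp : p.Prime) (h : p ∣ 16) : p = 2 :=
  (Nat.prime_dvd_prime_iff_eq hp Nat.prime_two).mp
    (hp.dvd_of_dvd_pow (show p ∣ 2 ^ 4 from by norm_num; exact h))

/-- `ab(a+b)` is even. -/
theorem two_dvd_abc (a b : ℕ) : 2 ∣ a * b * (a + b) := by
  apply Even.two_dvd
  rcases Nat.even_or_odd a with h | h
  · exact (h.mul_right b).mul_right (a + b)
  · rcases Nat.even_or_odd b with h' | h'
    · exact (h'.mul_left a).mul_right (a + b)
    · exact (h.add_odd h').mul_left (a * b)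

/-- **The full conductor proxy of the Frey pair is at most twice the radical**: the primes of
`Δ = 16(abc)²` are those of `abc` (`2 ∣ abc`); an odd one does not divide `c₄ = 16(a²+ab+b²)`
(`not_dvd_freyA_of_dvd_abc`) and is charged `p`, and `2` is charged at most `2² = 2·2`. -/
theorem nstar_freyPair_le {a b : ℕ} (ha : 0 < a) (hb : 0 < b) (hab : Nat.Coprime a b) :
    ∏ p ∈ (((freyPair a b).1 ^ 3 - (freyPair a b).2 ^ 2) / 1728).natAbs.primeFactors,
        (if ((p : ℕ) : ℤ) ∣ (freyPair a b).1 then p ^ 2 else p) ≤ 2 * rad a b (a + b) := by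
  rw [natAbs_freyPair_delta]
  set m : ℕ := a * b * (a + b) with hm
  have hm0 : m ≠ 0 := by positivity
  have hsub : (16 * m ^ 2).primeFactors ⊆ m.primeFactors := by
    intro p hp
    have hpp : p.Prime := Nat.prime_of_mem_primeFactors hp
    have hdvd : p ∣ 16 * m ^ 2 := Nat.dvd_of_mem_primeFactors hp
    refine Nat.mem_primeFactors.mpr ⟨hpp, ?_, hm0⟩
    rcases (Nat.Prime.dvd_mul hpp).mp hdvd with h | h
    · rw [eq_two_of_dvd_sixteen hpp h, hm]
      exact two_dvd_abc a b
    · exact hpp.dvd_of_dvd_pow h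
  have hle : ∀ p ∈ m.primeFactors,
      (if ((p : ℕ) : ℤ) ∣ (freyPair a b).1 then p ^ 2 else p) ≤ p * (if p = 2 then 2 else 1) := by
    intro p hp
    have hpp : p.Prime := Nat.prime_of_mem_primeFactors hp
    have hpm : p ∣ m := Nat.dvd_of_mem_primeFactors hp
    by_cases hp2 : p = 2
    · subst hp2
      rw [if_pos (rfl : (2 : ℕ) = 2)]
      split_ifs <;> norm_num
    · rw [if_neg hp2, mul_one, if_neg]
      intro hdiv
      rw [freyPair_fst] at hdiv
      have hp' : Prime (p : ℤ) := Nat.prime_iff_prime_int.mp hpp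
      have hpA : (p : ℤ) ∣ freyA a b := by
        rcases hp'.dvd_or_dvd hdiv with h | h
        · exact absurd (eq_two_of_dvd_sixteen hpp (by exact_mod_cast h)) hp2
        · exact h
      refine not_dvd_freyA_of_dvd_abc hab hpp hpA ?_
      rw [hm] at hpm
      exact_mod_cast hpm
  calc ∏ p ∈ (16 * m ^ 2).primeFactors, (if ((p : ℕ) : ℤ) ∣ (freyPair a b).1 then p ^ 2 else p)
      ≤ ∏ p ∈ m.primeFactors, (if ((p : ℕ) : ℤ) ∣ (freyPair a b).1 then p ^ 2 else p) := by
        refine Finset.prod_le_prod_of_subset_of_one_le' hsub fun p hp _ => ?_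
        have h1 := (Nat.prime_of_mem_primeFactors hp).one_lt
        split_ifs
        · exact Nat.one_le_pow _ _ (by omega)
        · omega
    _ ≤ ∏ p ∈ m.primeFactors, p * (if p = 2 then 2 else 1) := Finset.prod_le_prod' hle
    _ = (∏ p ∈ m.primeFactors, p) * ∏ p ∈ m.primeFactors, (if p = 2 then 2 else 1) :=
        Finset.prod_mul_distrib
    _ ≤ rad a b (a + b) * 2 := by
        refine Nat.mul_le_mul ?_ ?_
        · rw [Literature.NumberTheory.DiophantineGeometry.rad_def, Nat.radical_eq_prod_primeFactors, ← hm]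
        · rw [Finset.prod_ite_eq']
          split_ifs <;> norm_num
    _ = 2 * rad a b (a + b) := mul_comm _ _

/-- **The simple radical of the Frey pair is `1`**: `c₄³ − c₆² = 2¹⁰·3³·(abc)²`, so every prime of it
divides it at least squared and the filtered product is empty. -/
theorem simpleRad_freyPair_eq_one (a b : ℕ) :
    ∏ p ∈ ((freyPair a b).1 ^ 3 - (freyPair a b).2 ^ 2).natAbs.primeFactors.filter
        (fun p : ℕ => ¬ (((p : ℕ) : ℤ) ^ 2 ∣ (freyPair a b).1 ^ 3 - (freyPair a b).2 ^ 2)), p = 1 := by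
  refine Finset.prod_eq_one fun p hp => ?_
  exfalso
  obtain ⟨hpF, hnd⟩ := Finset.mem_filter.mp hp
  apply hnd
  have hpp : p.Prime := Nat.prime_of_mem_primeFactors hpF
  have hdvd : (p : ℤ) ∣ (freyPair a b).1 ^ 3 - (freyPair a b).2 ^ 2 :=
    Int.ofNat_dvd_left.mpr (Nat.dvd_of_mem_primeFactors hpF)
  rw [freyPair_cube_sub_sq] at hdvd ⊢
  have hp' : Prime (p : ℤ) := Nat.prime_iff_prime_int.mp hpp
  by_cases hpm : (p : ℤ) ∣ (a : ℤ) * b * (a + b)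
  · exact Dvd.dvd.mul_left (Dvd.dvd.mul_left (pow_dvd_pow_of_dvd hpm 2) 16) 1728
  · have e : (1728 : ℤ) * (16 * ((a : ℤ) * b * (a + b)) ^ 2) = 27648 * ((a : ℤ) * b * (a + b)) ^ 2 := by
      ring
    rw [e] at hdvd ⊢
    have h1 : (p : ℤ) ∣ 27648 := by
      rcases hp'.dvd_or_dvd hdvd with h | h
      · exact h
      · exact absurd (hp'.dvd_of_dvd_pow h) hpm
    have h2 : p ∣ 2 ^ 10 * 3 ^ 3 := by norm_num; exact_mod_cast h1
    rcases (Nat.Prime.dvd_mul hpp).mp h2 with h | h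
    · rw [(Nat.prime_dvd_prime_iff_eq hpp Nat.prime_two).mp (hpp.dvd_of_dvd_pow h)]
      exact Dvd.dvd.mul_right (by norm_num) _
    · rw [(Nat.prime_dvd_prime_iff_eq hpp Nat.prime_three).mp (hpp.dvd_of_dvd_pow h)]
      exact Dvd.dvd.mul_right (by norm_num) _

/-- Pairs `(u, v)` with `|u|³ ≤ Y` and `|u³ − v²| ≤ 1728Y` form a finite set (`|u|, |v| ≤ 1729·max(Y,1)`),
so every deep-regime set is finite and its `Set.ncard` is an honest count. -/
theorem box_finite (Y : ℝ) :
    {x : ℤ × ℤ | ((|x.1| ^ 3 : ℤ) : ℝ) ≤ Y ∧ ((|x.1 ^ 3 - x.2 ^ 2| : ℤ) : ℝ) ≤ 1728 * Y}.Finite := by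
  set T : ℝ := 1729 * max Y 1 with hT
  have hY' : Y ≤ max Y 1 := le_max_left _ _
  have h1' : (1 : ℝ) ≤ max Y 1 := le_max_right _ _
  have hT1 : (1 : ℝ) ≤ T := by rw [hT]; linarith
  set N : ℕ := Nat.ceil T with hN
  have hTN : T ≤ N := Nat.le_ceil _
  have cube_le : ∀ {z : ℝ}, |z| ^ 3 ≤ T → |z| ≤ T := by
    intro z h
    rcases le_or_gt |z| 1 with h1 | h1
    · exact h1.trans hT1
    · have h2 : 0 ≤ |z| * (|z| ^ 2 - 1) := mul_nonneg (abs_nonneg _) (by nlinarith)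
      nlinarith [h2]
  have sq_le : ∀ {z : ℝ}, z ^ 2 ≤ T → |z| ≤ T := by
    intro z h
    rcases le_or_gt |z| 1 with h1 | h1
    · exact h1.trans hT1
    · have h2 : 0 ≤ |z| * (|z| - 1) := mul_nonneg (abs_nonneg _) (by linarith)
      have h3 : |z| ^ 2 = z ^ 2 := sq_abs z
      nlinarith [h2, h3]
  refine (Set.Finite.prod (Set.finite_Icc (-(N : ℤ)) N) (Set.finite_Icc (-(N : ℤ)) N)).subset ?_
  rintro ⟨x, y⟩ ⟨hx, hxy⟩
  simp only [Set.mem_prod, Set.mem_Icc]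
  have hx3 : |(x : ℝ)| ^ 3 ≤ Y := by
    have e : (((|x| ^ 3 : ℤ)) : ℝ) = |(x : ℝ)| ^ 3 := by rw [Int.cast_pow, Int.cast_abs]
    rw [← e]; exact hx
  have hxy' : |(x : ℝ) ^ 3 - (y : ℝ) ^ 2| ≤ 1728 * Y := by
    have e : (((|x ^ 3 - y ^ 2| : ℤ)) : ℝ) = |(x : ℝ) ^ 3 - (y : ℝ) ^ 2| := by
      rw [Int.cast_abs, Int.cast_sub, Int.cast_pow, Int.cast_pow]
    rw [← e]; exact hxy
  have hxT : |(x : ℝ)| ^ 3 ≤ T := by rw [hT]; linarith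
  have hx' : |(x : ℝ)| ≤ N := (cube_le hxT).trans hTN
  have hy2 : (y : ℝ) ^ 2 ≤ T := by
    have h2 : (x : ℝ) ^ 3 ≤ |(x : ℝ)| ^ 3 := by rw [← abs_pow]; exact le_abs_self _
    have h5 := (abs_le.mp hxy').1
    rw [hT]; linarith
  have hy' : |(y : ℝ)| ≤ N := (sq_le hy2).trans hTN
  have hx'' : |x| ≤ (N : ℤ) := by exact_mod_cast hx'
  have hy'' : |y| ≤ (N : ℤ) := by exact_mod_cast hy'
  exact ⟨⟨(abs_le.mp hx'').1, (abs_le.mp hx'').2⟩, ⟨(abs_le.mp hy'').1, (abs_le.mp hy'').2⟩⟩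

/-! ## 2. The Frey pair lies in the deep-regime set -/

/-- **Membership.** For coprime positive `a, b` and `2·rad(ab(a+b)) ≤ X`, `(16A)³ ≤ Y < 2(16A)³`,
`Y < 256(ab(a+b))⁴` (`A = a²+ab+b²`), the Frey pair lies in the deep-regime set at `(X, Y)` (the set of
`stub_deepRegime`, verbatim): level `M⁺ = |c₄|³ = (16A)³ ∈ (Y/2, Y]` (`16(abc)² ≤ (16A)³` by the syzygy),
`N* ≤ 2·rad ≤ X`, tube `|c₄³ − c₆²| = 1728·16(abc)² > 1728Y^{1/2}`, simple radical `1 < Y^{1/6}`. -/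
theorem freyPair_mem_deep {a b : ℕ} (ha : 0 < a) (hb : 0 < b) (hcop : Nat.Coprime a b) {X Y : ℝ}
    (hX : 2 * (rad a b (a + b) : ℝ) ≤ X)
    (hY1 : (16 * ((a : ℝ) ^ 2 + a * b + (b : ℝ) ^ 2)) ^ 3 ≤ Y)
    (hY2 : Y < 2 * (16 * ((a : ℝ) ^ 2 + a * b + (b : ℝ) ^ 2)) ^ 3)
    (hY3 : Y < 256 * ((a : ℝ) * b * (a + b)) ^ 4) :
    freyPair a b ∈ {x : ℤ × ℤ | (x.1 ≠ 0 ∧ x.2 ≠ 0 ∧ x.1 ^ 3 ≠ x.2 ^ 2 ∧ (1728 : ℤ) ∣ x.1 ^ 3 - x.2 ^ 2 ∧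
        ((∀ p : ℕ, p.Prime → 5 ≤ p → ¬ ((p : ℤ) ^ 4 ∣ x.1 ∧ (p : ℤ) ^ 6 ∣ x.2)) ∧
          ¬ ((2 : ℤ) ^ 8 ∣ x.1 ∧ (2 : ℤ) ^ 11 ∣ x.2) ∧ ¬ ((3 : ℤ) ^ 5 ∣ x.1 ∧ (3 : ℤ) ^ 9 ∣ x.2)) ∧
        ((|x.1| ^ 3 : ℤ) : ℝ) ≤ Y ∧ ((|x.1 ^ 3 - x.2 ^ 2| : ℤ) : ℝ) ≤ 1728 * Y ∧
        Y < 2 * max (((|x.1| ^ 3 : ℤ) : ℝ)) (((|x.1 ^ 3 - x.2 ^ 2| : ℤ) : ℝ) / 1728) ∧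
        ((∏ p ∈ ((x.1 ^ 3 - x.2 ^ 2) / 1728).natAbs.primeFactors,
            (if ((p : ℕ) : ℤ) ∣ x.1 then p ^ 2 else p) : ℕ) : ℝ) ≤ X) ∧
      (¬ (((|x.1 ^ 3 - x.2 ^ 2| : ℤ) : ℝ) ≤ 1728 * Y ^ (1 / 2 : ℝ)) ∧
        ((∏ p ∈ (x.1 ^ 3 - x.2 ^ 2).natAbs.primeFactors.filter
            (fun p : ℕ => ¬ (((p : ℕ) : ℤ) ^ 2 ∣ x.1 ^ 3 - x.2 ^ 2)), p : ℕ) : ℝ) < Y ^ (1 / 6 : ℝ))} := by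
  -- `a ≠ b` (else `a = b = 1`, `c = 2`: `110592 ≤ Y < 4096`)
  have hab : a ≠ b := by
    rintro rfl
    have h1 : a = 1 := by simpa [Nat.Coprime] using hcop
    subst h1
    norm_num at hY1 hY3
    linarith
  have ha1 : (1 : ℝ) ≤ a := by exact_mod_cast ha
  have hb1 : (1 : ℝ) ≤ b := by exact_mod_cast hb
  set A : ℝ := (a : ℝ) ^ 2 + a * b + (b : ℝ) ^ 2 with hA
  set M : ℝ := (a : ℝ) * b * (a + b) with hM
  have hApos : 0 < A := by rw [hA]; positivity
  have hMpos : 0 < M := by rw [hM]; positivity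
  have hAZ : 0 < freyA a b := by unfold freyA; positivity
  have cast1 : (((|(freyPair a b).1| ^ 3 : ℤ)) : ℝ) = (16 * A) ^ 3 := by
    rw [freyPair_fst, abs_of_pos (by positivity : (0 : ℤ) < 16 * freyA a b), hA]
    push_cast [freyA]
    ring
  have cast2 : (((|(freyPair a b).1 ^ 3 - (freyPair a b).2 ^ 2| : ℤ)) : ℝ) = 1728 * (16 * M ^ 2) := by
    rw [freyPair_cube_sub_sq, abs_of_nonneg (by positivity), hM]
    push_cast
    ring
  -- `16M² ≤ (16A)³` from the syzygy `4A³ = P² + 27M²`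
  have hMA : 16 * M ^ 2 ≤ (16 * A) ^ 3 := by
    have e : 4 * A ^ 3 = (((b : ℝ) - a) * (2 * a + b) * (a + 2 * b)) ^ 2 + 27 * M ^ 2 := by
      rw [hA, hM]; ring
    nlinarith [sq_nonneg (((b : ℝ) - a) * (2 * a + b) * (a + 2 * b)), sq_nonneg M]
  have hY0 : 0 < Y := lt_of_lt_of_le (by positivity) hY1
  have hY1' : 1 < Y := by
    have h16 : (16 : ℝ) ≤ 16 * A := by rw [hA]; nlinarith
    have h3 := pow_le_pow_left₀ (by norm_num : (0 : ℝ) ≤ 16) h16 3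
    linarith
  rw [Set.mem_setOf_eq]
  refine ⟨⟨?_, ?_, ?_, ⟨16 * ((a : ℤ) * b * (a + b)) ^ 2, freyPair_cube_sub_sq a b⟩, tf_freyPair hcop,
    ?_, ?_, ?_, ?_⟩, ?_, ?_⟩
  · rw [freyPair_fst]; positivity
  · rw [freyPair_snd]
    have h1 : (b : ℤ) - a ≠ 0 := sub_ne_zero.mpr (by exact_mod_cast hab.symm)
    have h2 : (2 * (a : ℤ) + b) ≠ 0 := by positivity
    have h3 : ((a : ℤ) + 2 * b) ≠ 0 := by positivity
    exact mul_ne_zero (mul_ne_zero (mul_ne_zero (by norm_num) h1) h2) h3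
  · intro h
    have e := freyPair_cube_sub_sq a b
    rw [h, sub_self] at e
    have haZ : (0 : ℤ) < a := by exact_mod_cast ha
    have hbZ : (0 : ℤ) < b := by exact_mod_cast hb
    have : (0 : ℤ) < 1728 * (16 * ((a : ℤ) * b * (a + b)) ^ 2) := by positivity
    linarith
  · -- `|c₄|³ ≤ Y`
    rw [cast1]; exact hY1
  · -- `|c₄³ − c₆²| ≤ 1728Y`
    rw [cast2]; linarith
  · -- `Y < 2·M⁺`
    rw [cast1]; exact lt_of_lt_of_le hY2 (mul_le_mul_of_nonneg_left (le_max_left _ _) (by norm_num))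
  · -- `N* ≤ 2·rad ≤ X`
    have h := nstar_freyPair_le ha hb hcop
    have h' : ((∏ p ∈ (((freyPair a b).1 ^ 3 - (freyPair a b).2 ^ 2) / 1728).natAbs.primeFactors,
        (if ((p : ℕ) : ℤ) ∣ (freyPair a b).1 then p ^ 2 else p) : ℕ) : ℝ) ≤
        ((2 * rad a b (a + b) : ℕ) : ℝ) := by exact_mod_cast h
    refine h'.trans ?_
    push_cast; exact hX
  · -- the tube: `1728·Y^{1/2} < 1728·16M²` since `Y < 256M⁴`
    rw [cast2, not_le]
    have hsq : (Y ^ (1 / 2 : ℝ)) ^ 2 = Y := by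
      rw [← Real.rpow_natCast (Y ^ (1 / 2 : ℝ)) 2, ← Real.rpow_mul hY0.le]; norm_num
    have hlt : Y ^ (1 / 2 : ℝ) < 16 * M ^ 2 := by
      refine not_le.mp fun hge => ?_
      have h2 := pow_le_pow_left₀ (by positivity : (0 : ℝ) ≤ 16 * M ^ 2) hge 2
      rw [hsq] at h2
      linarith
    linarith
  · -- the simple radical is `1 < Y^{1/6}`
    rw [simpleRad_freyPair_eq_one a b, Nat.cast_one]
    exact Real.one_lt_rpow hY1' (by norm_num)

/-! ## 3. Arithmetic of the dyadic levels -/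

/-- The tube inequality on the dyadic levels: `2(16A)³ < 256(ab(a+b))⁴` for `a, b ≥ 1`, `a + b ≥ 9`
(`(16A)³ < 4096c⁶` as `A < c²`, and `8192c⁶ ≤ 9216c⁶ ≤ 256(ab)⁴c⁴` as `(ab)² ≥ (c−1)² ≥ 6c`). -/
theorem two_mul_level_lt {a b : ℝ} (ha : 1 ≤ a) (hb : 1 ≤ b) (hc : 9 ≤ a + b) :
    2 * (16 * (a ^ 2 + a * b + b ^ 2)) ^ 3 < 256 * (a * b * (a + b)) ^ 4 := by
  have ha0 : 0 ≤ a := by linarith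
  have hb0 : 0 ≤ b := by linarith
  have hPc : a + b - 1 ≤ a * b := by linarith [mul_nonneg (sub_nonneg.mpr ha) (sub_nonneg.mpr hb)]
  have hP2 : 6 * (a + b) ≤ (a * b) ^ 2 := by
    have h6 : 6 * (a + b) ≤ (a + b - 1) ^ 2 := by
      nlinarith [mul_nonneg (sub_nonneg.mpr hc) (by linarith : (0 : ℝ) ≤ a + b + 1)]
    exact h6.trans (pow_le_pow_left₀ (by linarith) hPc 2)
  have hP4 : (6 * (a + b)) ^ 2 ≤ ((a * b) ^ 2) ^ 2 := pow_le_pow_left₀ (by positivity) hP2 2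
  have hA_lt : 16 * (a ^ 2 + a * b + b ^ 2) < 16 * (a + b) ^ 2 := by
    nlinarith [mul_pos (by linarith : (0 : ℝ) < a) (by linarith : (0 : ℝ) < b)]
  have hm_lt : (16 * (a ^ 2 + a * b + b ^ 2)) ^ 3 < (16 * (a + b) ^ 2) ^ 3 :=
    pow_lt_pow_left₀ hA_lt (by positivity) three_ne_zero
  have hc6 : 0 ≤ (a + b) ^ 6 := by positivity
  calc 2 * (16 * (a ^ 2 + a * b + b ^ 2)) ^ 3 < 2 * (16 * (a + b) ^ 2) ^ 3 := by linarith
    _ = 8192 * (a + b) ^ 6 := by ring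
    _ ≤ 256 * (6 * (a + b)) ^ 2 * (a + b) ^ 4 := by nlinarith [hc6]
    _ ≤ 256 * ((a * b) ^ 2) ^ 2 * (a + b) ^ 4 :=
        mul_le_mul_of_nonneg_right (mul_le_mul_of_nonneg_left hP4 (by norm_num)) (by positivity)
    _ = 256 * (a * b * (a + b)) ^ 4 := by ring

/-- Registered sub-goal `deepRegimeFreyPairs_main` of stmt-ABC-1975 (support 1/2 of the calibration
`mazurKaneLaw_of_deepRegimeLaw`, line `deep-moduli-cusp-dispersion`): for a coprime pair of positive
integers, the full conductor proxy `N*` of the Frey pair is at most twice the radical and its simple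
radical is `1`. -/
theorem deepRegimeFreyPairs_main : ∀ a b : ℕ, 0 < a → 0 < b → Nat.Coprime a b → (∏ p ∈ (((freyPair a b).1 ^ 3 - (freyPair a b).2 ^ 2) / 1728).natAbs.primeFactors, (if ((p : ℕ) : ℤ) ∣ (freyPair a b).1 then p ^ 2 else p)) ≤ 2 * Literature.NumberTheory.DiophantineGeometry.rad a b (a + b) ∧ (∏ p ∈ ((freyPair a b).1 ^ 3 - (freyPair a b).2 ^ 2).natAbs.primeFactors.filter (fun p : ℕ => ¬ (((p : ℕ) : ℤ) ^ 2 ∣ (freyPair a b).1 ^ 3 - (freyPair a b).2 ^ 2)), p) = 1 :=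
  fun a b ha hb hab => ⟨nstar_freyPair_le ha hb hab, simpleRad_freyPair_eq_one a b⟩

end Summit.ABC.ABC.Theorems.SharpModerateLaw.CuspDispersion

end
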